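import Mathlib
import HarnessLib
import Summits.Ventures.LatticeQCDFlow.Scaling.FreeEnergyBudget
import Summits.Ventures.LatticeQCDFlow.Scaling.PerfectRelaxationSufficiency

/-!
# LatticeQCDFlow / Scaling — the TELESCOPING IDENTITY for uniform annealing (v2.5)

HONEST FRAMING: exact (Metropolis-corrected) sampling algorithms for lattice gauge theory; figures
of merit are autocorrelation/cost numbers at stated couplings and volumes; no continuum-physics
claim.

Venture `LatticeQCDFlow` (cell pub-lqcd), topic `Scaling`, FANOUT row 29 (theory2) — OUR WORK
(THEORY-2.md v2.5 §3.5 (viii) / §4 row C3).  Finite-state, elementary; nothing is cited as a fact.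
Imports `PerfectRelaxationSufficiency` (item 29) and the tree's `FreeEnergyBudget`
(`mean_action_le`).

For the exponential family `p_β ∝ e^{−βA}` with log-partition function `F(β) = log Σ_x e^{−βA(x)}`
(`logPartFn`), the one-step ESS is a SECOND DIFFERENCE of `F`:
`−log ESS(p_{β+h}, p_β) = F(β) + F(β+2h) − 2F(β+h)` (`negLog_essFrac_expFamily`; `ESS =
Z_{β+h}²/(Z_β Z_{β+2h})`, `essFrac_expFamily_eq`).  Along the UNIFORM protocol `β_k = β₀ + kh`,
`h = Δ/n`, the sum TELESCOPES:

* `negLog_prod_essFrac_unif` — **`−log Π_{k<n} ESS(p_{k+1}, p_k) = [F(β₀+Δ+h) − F(β₀+Δ)] −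
  [F(β₀+h) − F(β₀)]`** exactly: the total cost of perfectly relaxed uniform annealing is the change
  of the discrete free-energy slope between the two ends.
* `negLog_prod_essFrac_unif_le` — by convexity of `F` (tree `mean_action_le`, slope `−⟨A⟩_β`):
  **`−log Π_k ESS ≤ (Δ/n)·(⟨A⟩_{β₀} − ⟨A⟩_{β₀+Δ+Δ/n})`** — "step size × total drop of the mean
  action"; with `a ≤ A ≤ b` this is `≤ Δ(b − a)/n` (`prod_essFrac_unif_ge'`), LINEAR in `Δ·osc(A)`
  and therefore much better than item 29's `Δ²(b−a)²/(4n)` as soon as `Δ(b − a) > 4`.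
* `perfectRelaxation_sites_ge_linear` — `m` independent sites, perfect relaxation:
  **`ÊSS ≥ exp(−m·Δ(b − a)/n)`**; together with item 28b, `exp(−mΔ(b−a)/n) ≤ ÊSS ≤
  exp(−m‖√p_n − √p_0‖²_site/n)`: BOTH exponents are `(m/n) × (an O(1) single-site constant)`.
-/

noncomputable section

namespace Summit.Ventures.LatticeQCDFlow.Theory2

open Finset Summit.Ventures.LatticeQCDFlow.Exactness

variable {X : Type*} [Fintype X] [Nonempty X]

/-! ## The log-partition function and the mean action of an exponential family -/

/-- `F(β) = log Z(β)`, `Z(β) = Σ_x e^{−βA(x)}`, of the exponential family `p_β ∝ e^{−βA}`.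
[folklore] -/
def logPartFn (A : X → ℝ) (β : ℝ) : ℝ := Real.log (partitionFn fun x => β * A x)

/-- The mean action `⟨A⟩_β = Σ_x p_β(x)·A(x)`. [folklore] -/
def meanObs (A : X → ℝ) (β : ℝ) : ℝ := ∑ x, gibbsLaw (fun x => β * A x) x * A x

omit [Nonempty X] in
/-- Bridge to the tree's tilted laws with unit reference weights: `tiltZ 1 A β = Z(β)`.
[folklore] -/
theorem tiltZ_one_eq (A : X → ℝ) (β : ℝ) :
    tiltZ (fun _ => (1 : ℝ)) A β = partitionFn fun x => β * A x := by
  simp [tiltZ, partitionFn]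

omit [Nonempty X] in
/-- `tiltLaw 1 A β = p_β`. [folklore] -/
theorem tiltLaw_one_eq (A : X → ℝ) (β : ℝ) (x : X) :
    tiltLaw (fun _ => (1 : ℝ)) A β x = gibbsLaw (fun x => β * A x) x := by
  simp [tiltLaw, gibbsLaw, tiltZ_one_eq]

/-- Convexity of `F`, lower secant: `F(β + h) − F(β) ≥ −h·⟨A⟩_β` (tree `mean_action_le`).
[folklore] -/
theorem logPartFn_sub_ge (A : X → ℝ) (β h : ℝ) :
    -(h * meanObs A β) ≤ logPartFn A (β + h) - logPartFn A β := by
  have := mean_action_le (η := fun _ => (1 : ℝ)) (fun _ => one_pos) A β (β + h)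
  simp only [tiltZ_one_eq, tiltLaw_one_eq] at this
  simp only [meanObs, logPartFn]
  linarith

/-- Convexity of `F`, upper secant: `F(β + h) − F(β) ≤ −h·⟨A⟩_{β+h}`. [folklore] -/
theorem logPartFn_sub_le (A : X → ℝ) (β h : ℝ) :
    logPartFn A (β + h) - logPartFn A β ≤ -(h * meanObs A (β + h)) := by
  have := mean_action_le (η := fun _ => (1 : ℝ)) (fun _ => one_pos) A (β + h) β
  simp only [tiltZ_one_eq, tiltLaw_one_eq] at this
  simp only [meanObs, logPartFn]
  linarith

omit [Nonempty X] in
/-- `a ≤ A ≤ b ⟹ a ≤ ⟨A⟩_β ≤ b`. [folklore] -/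
theorem meanObs_mem (A : X → ℝ) {a b : ℝ} (hA : ∀ x, a ≤ A x ∧ A x ≤ b) (β : ℝ) [Nonempty X] :
    a ≤ meanObs A β ∧ meanObs A β ≤ b := by
  have hp0 : ∀ x, 0 ≤ gibbsLaw (fun x => β * A x) x := fun x => (gibbsLaw_pos _ x).le
  have hp1 : ∑ x, gibbsLaw (fun x => β * A x) x = 1 := sum_gibbsLaw _
  constructor
  · calc a = ∑ x, gibbsLaw (fun x => β * A x) x * a := by rw [← sum_mul, hp1, one_mul]
      _ ≤ meanObs A β := sum_le_sum fun x _ => mul_le_mul_of_nonneg_left (hA x).1 (hp0 x)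
  · calc meanObs A β ≤ ∑ x, gibbsLaw (fun x => β * A x) x * b :=
          sum_le_sum fun x _ => mul_le_mul_of_nonneg_left (hA x).2 (hp0 x)
      _ = b := by rw [← sum_mul, hp1, one_mul]

/-! ## `ESS = Z₁²/(Z₀Z₂)` and `−log ESS` as a second difference -/

/-- `ESS(p_{β+h}, p_β) = Z(β+h)²/(Z(β)·Z(β+2h))`. [folklore] -/
theorem essFrac_expFamily_eq (A : X → ℝ) (β h : ℝ) :
    essFrac (gibbsLaw fun x => (β + h) * A x) (gibbsLaw fun x => β * A x) =
      (partitionFn fun x => (β + h) * A x) ^ 2 /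
        ((partitionFn fun x => β * A x) * partitionFn fun x => (β + 2 * h) * A x) := by
  have hZ₁ : 0 < partitionFn fun x => (β + h) * A x := partitionFn_pos _
  have hZ₀ : 0 < partitionFn fun x => β * A x := partitionFn_pos _
  have hZ₂ : 0 < partitionFn fun x => (β + 2 * h) * A x := partitionFn_pos _
  have hl : ∑ x, gibbsLaw (fun x => (β + h) * A x) x *
      weight (gibbsLaw fun x => (β + h) * A x) (gibbsLaw fun x => β * A x) x =
        (partitionFn fun x => β * A x) / (partitionFn fun x => (β + h) * A x) ^ 2 *
          partitionFn fun x => (β + 2 * h) * A x := by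
    rw [show (partitionFn fun x => (β + 2 * h) * A x) = ∑ x, Real.exp (-((β + 2 * h) * A x))
      from rfl, mul_sum]
    refine sum_congr rfl fun x _ => ?_
    simp only [weight, gibbsLaw]
    have he : Real.exp (-((β + 2 * h) * A x)) =
        Real.exp (-((β + h) * A x)) * Real.exp (-((β + h) * A x)) / Real.exp (-(β * A x)) := by
      rw [← Real.exp_add, ← Real.exp_sub]
      congr 1
      ring
    rw [he]
    field_simp
  rw [essFrac_eq_inv (gibbsLaw_pos _) (sum_gibbsLaw _), hl]
  field_simp

/-- `ESS(p_{β+h}, p_β) > 0`. [folklore] -/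
theorem essFrac_expFamily_pos (A : X → ℝ) (β h : ℝ) :
    0 < essFrac (gibbsLaw fun x => (β + h) * A x) (gibbsLaw fun x => β * A x) := by
  rw [essFrac_expFamily_eq]
  exact div_pos (pow_pos (partitionFn_pos _) 2) (mul_pos (partitionFn_pos _) (partitionFn_pos _))

/-- **`−log ESS(p_{β+h}, p_β) = F(β) + F(β + 2h) − 2F(β + h)`** — a second difference of the
log-partition function. [folklore] -/
theorem negLog_essFrac_expFamily (A : X → ℝ) (β h : ℝ) :
    -Real.log (essFrac (gibbsLaw fun x => (β + h) * A x) (gibbsLaw fun x => β * A x)) =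
      logPartFn A β + logPartFn A (β + 2 * h) - 2 * logPartFn A (β + h) := by
  have hZ₁ : 0 < partitionFn fun x => (β + h) * A x := partitionFn_pos _
  have hZ₀ : 0 < partitionFn fun x => β * A x := partitionFn_pos _
  have hZ₂ : 0 < partitionFn fun x => (β + 2 * h) * A x := partitionFn_pos _
  rw [essFrac_expFamily_eq, Real.log_div (pow_pos hZ₁ 2).ne' (mul_pos hZ₀ hZ₂).ne',
    Real.log_pow, Real.log_mul hZ₀.ne' hZ₂.ne']
  simp only [logPartFn]
  push_cast
  ring

/-! ## The telescoping identity along the uniform protocol -/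

/-- **TELESCOPING IDENTITY.**  Along `β_k = β₀ + kΔ/n`:
`−log Π_{k<n} ESS(p_{k+1}, p_k) = [F(β₀+Δ+Δ/n) − F(β₀+Δ)] − [F(β₀+Δ/n) − F(β₀)]`. [folklore] -/
theorem negLog_prod_essFrac_unif (A : X → ℝ) (β₀ Δ : ℝ) {n : ℕ} (hn : 0 < n) :
    -Real.log (∏ k : Fin n, essFrac (gibbsLaw fun x => unifProtocol β₀ Δ n k.succ * A x)
        (gibbsLaw fun x => unifProtocol β₀ Δ n k.castSucc * A x)) =
      (logPartFn A (β₀ + Δ + Δ / n) - logPartFn A (β₀ + Δ)) -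
        (logPartFn A (β₀ + Δ / n) - logPartFn A β₀) := by
  have hn' : (n : ℝ) ≠ 0 := by exact_mod_cast hn.ne'
  -- the discrete slope `G i = F(β₀ + (i+1)Δ/n) − F(β₀ + iΔ/n)`
  obtain ⟨G, hG⟩ : ∃ G : ℕ → ℝ, ∀ i : ℕ, G i =
      logPartFn A (β₀ + ((i : ℝ) + 1) * (Δ / n)) - logPartFn A (β₀ + (i : ℝ) * (Δ / n)) :=
    ⟨_, fun i => rfl⟩
  have hterm : ∀ k : Fin n,
      -Real.log (essFrac (gibbsLaw fun x => unifProtocol β₀ Δ n k.succ * A x)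
        (gibbsLaw fun x => unifProtocol β₀ Δ n k.castSucc * A x)) = G ((k : ℕ) + 1) - G k := by
    intro k
    simp_rw [unifProtocol_succ]
    rw [negLog_essFrac_expFamily, hG, hG]
    simp only [unifProtocol, Fin.val_castSucc]
    push_cast
    ring_nf
  rw [Real.log_prod fun k _ => by
      simp_rw [unifProtocol_succ]; exact (essFrac_expFamily_pos A _ _).ne', ← sum_neg_distrib]
  simp_rw [hterm]
  rw [Fin.sum_univ_eq_sum_range (fun i => G (i + 1) - G i) n, sum_range_sub, hG n, hG 0]
  have hnh : (n : ℝ) * (Δ / n) = Δ := by rw [mul_div_assoc']; exact mul_div_cancel_left₀ Δ hn'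
  have e1 : β₀ + ((n : ℝ) + 1) * (Δ / n) = β₀ + Δ + Δ / n := by
    rw [add_mul, one_mul, hnh, add_assoc]
  have e2 : β₀ + (n : ℝ) * (Δ / n) = β₀ + Δ := by rw [hnh]
  have e3 : β₀ + (((0 : ℕ) : ℝ) + 1) * (Δ / n) = β₀ + Δ / n := by simp
  have e4 : β₀ + ((0 : ℕ) : ℝ) * (Δ / n) = β₀ := by simp
  rw [e1, e2, e3, e4]

/-- **`−log Π_k ESS ≤ (Δ/n)·(⟨A⟩_{β₀} − ⟨A⟩_{β₀+Δ+Δ/n})`** — step size times the total drop of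
the mean action (convexity of `F`). [folklore] -/
theorem negLog_prod_essFrac_unif_le (A : X → ℝ) (β₀ Δ : ℝ) {n : ℕ} (hn : 0 < n) :
    -Real.log (∏ k : Fin n, essFrac (gibbsLaw fun x => unifProtocol β₀ Δ n k.succ * A x)
        (gibbsLaw fun x => unifProtocol β₀ Δ n k.castSucc * A x)) ≤
      Δ / n * (meanObs A β₀ - meanObs A (β₀ + Δ + Δ / n)) := by
  rw [negLog_prod_essFrac_unif A β₀ Δ hn]
  have h1 := logPartFn_sub_le A (β₀ + Δ) (Δ / n)
  have h2 := logPartFn_sub_ge A β₀ (Δ / n)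
  linarith

/-- **`Π_k ESS ≥ exp(−(Δ/n)(⟨A⟩_{β₀} − ⟨A⟩_{β₀+Δ+Δ/n})) ≥ exp(−Δ(b − a)/n)`** for `a ≤ A ≤ b`,
`Δ ≥ 0`. [folklore] -/
theorem prod_essFrac_unif_ge' (A : X → ℝ) {a b : ℝ} (hA : ∀ x, a ≤ A x ∧ A x ≤ b) (β₀ : ℝ)
    {Δ : ℝ} (hΔ : 0 ≤ Δ) {n : ℕ} (hn : 0 < n) :
    Real.exp (-(Δ * (b - a) / n)) ≤
      ∏ k : Fin n, essFrac (gibbsLaw fun x => unifProtocol β₀ Δ n k.succ * A x)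
        (gibbsLaw fun x => unifProtocol β₀ Δ n k.castSucc * A x) := by
  have hpos : 0 < ∏ k : Fin n, essFrac (gibbsLaw fun x => unifProtocol β₀ Δ n k.succ * A x)
      (gibbsLaw fun x => unifProtocol β₀ Δ n k.castSucc * A x) :=
    prod_pos fun k _ => by simp_rw [unifProtocol_succ]; exact essFrac_expFamily_pos A _ _
  rw [← Real.exp_log hpos]
  refine Real.exp_le_exp.2 ?_
  have hle := negLog_prod_essFrac_unif_le A β₀ Δ hn
  have hm0 := meanObs_mem A hA β₀
  have hm1 := meanObs_mem A hA (β₀ + Δ + Δ / n)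
  have hn' : (0 : ℝ) < n := by exact_mod_cast hn
  have hΔn : 0 ≤ Δ / n := div_nonneg hΔ hn'.le
  have : Δ / n * (meanObs A β₀ - meanObs A (β₀ + Δ + Δ / n)) ≤ Δ * (b - a) / n := by
    rw [mul_comm Δ (b - a), mul_div_assoc, mul_comm (b - a)]
    exact mul_le_mul_of_nonneg_left (by linarith [hm0.2, hm1.1]) hΔn
  linarith

/-! ## `m` independent sites -/

section Sites

variable {Z : Type*} [LinearOrder Z] [Fintype Z] [Nonempty Z] {m n : ℕ}

/-- **The exact identity on `m` sites**: with perfect relaxation and the uniform protocol,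
`−log ÊSS = m·([F(β₀+Δ+Δ/n) − F(β₀+Δ)] − [F(β₀+Δ/n) − F(β₀)])` (single-site `F`). [folklore] -/
theorem negLog_ess_perfect_relaxation_sites (m : ℕ) (A : Z → ℝ) (β₀ Δ : ℝ) (hn : 0 < n) :
    -Real.log (essFrac
        (revPathLaw (siteSum m A (unifProtocol β₀ Δ n)) fun k _ ψ =>
          gibbsLaw (siteSum m A (unifProtocol β₀ Δ n) k.succ) ψ)
        (pathLaw (gibbsLaw (siteSum m A (unifProtocol β₀ Δ n) 0)) fun k _ ψ =>
          gibbsLaw (siteSum m A (unifProtocol β₀ Δ n) k.succ) ψ)) =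
      m * ((logPartFn A (β₀ + Δ + Δ / n) - logPartFn A (β₀ + Δ)) -
        (logPartFn A (β₀ + Δ / n) - logPartFn A β₀)) := by
  rw [ess_perfect_relaxation_sites, Real.log_pow, ← negLog_prod_essFrac_unif A β₀ Δ hn]
  ring

/-- **LINEAR ACHIEVABILITY on `m` sites**: perfect relaxation, uniform protocol, `a ≤ A ≤ b`,
`Δ ≥ 0`: `ÊSS ≥ exp(−m·Δ(b − a)/n)`.  With item 28b's upper bound `exp(−m‖√p_n − √p_0‖²/n)`
both exponents are `(m/n)·O(1)`. [folklore] -/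
theorem perfectRelaxation_sites_ge_linear (m : ℕ) (A : Z → ℝ) {a b : ℝ}
    (hA : ∀ z, a ≤ A z ∧ A z ≤ b) (β₀ : ℝ) {Δ : ℝ} (hΔ : 0 ≤ Δ) (hn : 0 < n) :
    Real.exp (-((m : ℝ) * (Δ * (b - a) / n))) ≤
      essFrac
        (revPathLaw (siteSum m A (unifProtocol β₀ Δ n)) fun k _ ψ =>
          gibbsLaw (siteSum m A (unifProtocol β₀ Δ n) k.succ) ψ)
        (pathLaw (gibbsLaw (siteSum m A (unifProtocol β₀ Δ n) 0)) fun k _ ψ =>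
          gibbsLaw (siteSum m A (unifProtocol β₀ Δ n) k.succ) ψ) := by
  rw [ess_perfect_relaxation_sites, show -((m : ℝ) * (Δ * (b - a) / n)) =
      (m : ℕ) * (-(Δ * (b - a) / n)) by ring, Real.exp_nat_mul]
  exact pow_le_pow_left₀ (Real.exp_pos _).le (prod_essFrac_unif_ge' A hA β₀ hΔ hn) m

end Sites

end Summit.Ventures.LatticeQCDFlow.Theory2

end
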